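import Literature.NumberTheory.GaloisRepresentations.ContinuousShapiroLiftPairing
import Literature.NumberTheory.GaloisRepresentations.ContinuousH2
import HarnessLib

/-!
# Route `ResidualThetaTransportAtTwo` (RTT P6, item stmt-BirchSwinnertonDyer-23110, road T), H-PLUSDUAL brick (ISO-2):
# the summed cup product of two SHAPIRO LIFTS vanishes when the cup product vanishes on the subgroup
# («`cor_{N→G}(f ∪ g) = 0` if `f ∪ g = 0`», on cochains)

Width seat `bsd-wall-tp2-p2x-w2` g15 (cell `bsd-wall`), for the LEAD `bsd-wall-tp2-p2x` g12. HONEST FRAMING: THEOREMS ONLY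
(no definition, no named fact, no instance, no `sorry`); generic continuous group cohomology (no number theory); closes no item;
BSD is NOT proved by any of this.

Let `G` be a topological group, `N ≤ G` an open subgroup of finite index with coset representatives `s`, `X, Y, Z : TopRep R G`
and `P : X × Y → Z` a continuous equivariant pairing (`ContPairing`). The tree's Shapiro model of the cohomology of `N`
(`ContinuousShapiroLift*.lean`, crux K3 lineage) pairs two layer classes `[f] ∈ H¹(N, X)`, `[g] ∈ H¹(N, Y)` by the SUMMED pairing
of their Shapiro lifts, `Sh f ∪_{ΣP} Sh g ∈ H²(G, Z)` (`ContPairing.coindFin`) — the cochain form of `cor_{N → G}([f] ∪ [g])`.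
This file proves the vanishing half of that slogan ON COCHAINS, which is all the `±`-isotropy argument at `2` needs:

* **`cupProduct_shapiroCocycle_eq_zero_of_coboundary`** — if the inhomogeneous cup-product cocycle of `f` and `g` ON `N`,
  `(a, b) ↦ P(f a, a·g b)`, is the coboundary of a continuous cochain `β : N → Z`, then
  `(P.coindFin N).cupProduct [Sh f] [Sh g] = 0` in `H²(G, Z)`. Explicitly the `G`-cochain is the «transfer» of `β`,
  `B(σ) = Σ_{x ∈ G/N} s(σx) • β(s(σx)⁻¹ σ s(x))` (`transferCochain_apply`), and `Sh f ∪_{ΣP} Sh g = ∂B` term by term after the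
  reindexings `y = σx`, `x = τz` (the Schreier cocycle rule `n_{στ}(z) = n_σ(τz) n_τ(z)`).

Consumer: Kummer isotropy at a LAYER `U_m = Gal(ℚ̄_v/ℚ_{v,m})` of the local cyclotomic tower, transported to the Shapiro model in
which the (D-layer) local Tate pairing of crux K3 (`LayerPairing.layerPairingPk`) and the twisted `±`-local conditions of road T
(H-PLUSDUAL, B. D. Kim 2007 Prop. 3.15) are written.

References: J. Neukirch, A. Schmidt, K. Wingberg, *Cohomology of Number Fields* (2008), I §5 Prop. (1.5.3)(iv) (projection formula,
`cor` on inhomogeneous cochains via coset representatives), I §6 Prop. (1.6.4) (Shapiro) [NeukirchSchmidtWingberg2008];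
J.-P. Serre, *Local Fields* VII §5–§7 [SerreLocalFields1979].
-/

-- the Theorems namespace of this sub repeats the summit name by design (D-0017 nested layout)
set_option linter.dupNamespace false

noncomputable section

open CategoryTheory
open scoped Classical

universe u v

namespace Summit.BirchSwinnertonDyer.BirchSwinnertonDyer.Theorems.SignedEC.ShapiroCup

open _root_.TopRep Literature.NumberTheory.GaloisRepresentations
open Literature.NumberTheory.EllipticCurves (schreierElt schreierElt_mem schreierElt_coe rep_mul_schreierElt schreierElt_mul)

variable {R : Type u} [CommRing R] [TopologicalSpace R]
variable {G : Type v} [Group G] [TopologicalSpace G] [IsTopologicalGroup G]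

/-- **The transfer of a continuous `1`-cochain `β : N → Z`** along coset representatives `s` of an open subgroup `N`:
`B(σ) = Σ_{x ∈ G/N} s(σ • x) • β(s(σ • x)⁻¹ σ s(x))` is continuous (same argument as the tree's `continuous_transferFun`:
`G ⧸ N` is discrete). [cite: NeukirchSchmidtWingberg2008, I §5] -/
theorem continuous_transferCochain (Z : TopRep.{v} R G) (N : Subgroup G) [Fintype (G ⧸ N)] (hN : IsOpen (N : Set G))
    {s : G ⧸ N → G} (hs : ∀ x : G ⧸ N, (s x : G ⧸ N) = x) (β : C(N, Z)) :
    Continuous fun σ : G ↦ ∑ x : G ⧸ N, Z.ρ (s (σ • x)) (β (schreierElt N hs σ x)) := by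
  haveI : DiscreteTopology (G ⧸ N) := QuotientGroup.discreteTopology hN
  have hsm : ∀ x : G ⧸ N, Continuous fun g : G ↦ g • x := fun x ↦ continuous_id.smul continuous_const
  have hrep : ∀ x : G ⧸ N, Continuous fun g : G ↦ s (g • x) := fun x ↦ continuous_of_discreteTopology.comp (hsm x)
  have hsch : ∀ x : G ⧸ N, Continuous fun g : G ↦ schreierElt N hs g x := fun x ↦
    Continuous.subtype_mk (((hrep x).inv.mul continuous_id).mul continuous_const) fun g ↦ schreierElt_mem N hs g x
  have hF : Continuous fun q : (G ⧸ N) × Z ↦ Z.ρ (s q.1) q.2 :=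
    continuous_prod_of_discrete_left.mpr fun y ↦ (Z.ρ (s y)).continuous
  have hsummand : ∀ x : G ⧸ N, Continuous fun g : G ↦ Z.ρ (s (g • x)) (β (schreierElt N hs g x)) := fun x ↦
    hF.comp ((hsm x).prodMk (β.continuous.comp (hsch x)))
  exact continuous_finsetSum _ fun x _ ↦ hsummand x

/-- **`Sh f ∪_{ΣP} Sh g = 0` in `H²(G, Z)` when `f ∪ g = ∂β` on `N`** (the vanishing half of `cor(f ∪ g) = Sh f ∪_Σ Sh g`, on
cochains). For an open subgroup `N` of finite index with representatives `s`, crossed homomorphisms `f : N → X`, `g : N → Y` and a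
continuous cochain `β : N → Z` with `P(f a, a · g b) = a β(b) − β(ab) + β(a)` for all `a, b ∈ N`, the summed cup product of the
Shapiro lifts is the coboundary of the transfer `B` of `β`:
`Σ_y P(Sh f(σ)(y), (σ ⋆ Sh g(τ))(y)) = Σ_x s(σx) • P(f n_σ(x), n_σ(x) g n_τ(τ⁻¹x)) = σB(τ) − B(στ) + B(σ)`
(`y = σx`; `σ s(x) = s(σx) n_σ(x)`; `n_σ(x) n_τ(τ⁻¹x) = n_{στ}(τ⁻¹x)`; `x = τz`).
[cite: NeukirchSchmidtWingberg2008, I §5 Prop. (1.5.3)(iv), I §6 Prop. (1.6.4)] -/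
theorem cupProduct_shapiroCocycle_eq_zero_of_coboundary [LocallyCompactSpace G] {X Y Z : TopRep.{v} R G}
    (P : ContPairing X Y Z) (N : Subgroup G) [Fintype (G ⧸ N)] (hN : IsOpen (N : Set G))
    {s : G ⧸ N → G} (hs : ∀ x : G ⧸ N, (s x : G ⧸ N) = x)
    (f : contOneCocycles (subgroupRep X N)) (g : contOneCocycles (subgroupRep Y N)) (β : C(N, Z))
    (hβ : ∀ a b : N, P.toLin (f.1 a) (Y.ρ (a : G) (g.1 b)) = Z.ρ (a : G) (β b) - β (a * b) + β a) :
    (P.coindFin N).cupProduct (oneCocycleClass _ (shapiroCocycle X N hN hs f))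
      (oneCocycleClass _ (shapiroCocycle Y N hN hs g)) = 0 := by
  rw [ContPairing.cupProduct_oneCocycleClass_eq_twoCocycleClass, twoCocycleClass_eq_zero_iff]
  refine ⟨⟨fun σ ↦ ∑ x : G ⧸ N, Z.ρ (s (σ • x)) (β (schreierElt N hs σ x)), continuous_transferCochain Z N hN hs β⟩,
    fun σ τ ↦ ?_⟩
  rw [ContPairing.cupCocycle_apply_eq_smul]
  change (P.coindFin N).toLin ((shapiroCocycle X N hN hs f).1 σ) ((coindFin Y N).ρ σ ((shapiroCocycle Y N hN hs g).1 τ)) =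
    Z.ρ σ (∑ x : G ⧸ N, Z.ρ (s (τ • x)) (β (schreierElt N hs τ x))) -
      (∑ x : G ⧸ N, Z.ρ (s ((σ * τ) • x)) (β (schreierElt N hs (σ * τ) x))) +
      ∑ x : G ⧸ N, Z.ρ (s (σ • x)) (β (schreierElt N hs σ x))
  rw [ContPairing.coindFin_toLin_apply]
  -- the summand at `y = σ • x`
  have hsummand : ∀ x : G ⧸ N,
      P.toLin ((shapiroCocycle X N hN hs f).1 σ (σ • x)) ((coindFin Y N).ρ σ ((shapiroCocycle Y N hN hs g).1 τ) (σ • x)) =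
        Z.ρ (s (σ • x)) (Z.ρ ((schreierElt N hs σ x : N) : G) (β (schreierElt N hs τ (τ⁻¹ • x)))) -
          Z.ρ (s (σ • x)) (β (schreierElt N hs σ x * schreierElt N hs τ (τ⁻¹ • x))) +
          Z.ρ (s (σ • x)) (β (schreierElt N hs σ x)) := by
    intro x
    rw [shapiroCocycle_apply, inv_smul_smul, coindFin_ρ_apply, inv_smul_smul, shapiroCocycle_apply, ← ρ_mul_apply,
      ← rep_mul_schreierElt N hs σ x, ρ_mul_apply, P.toLin_smul, hβ, map_add, map_sub]
  -- reindex the left-hand side along `x ↦ σ • x`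
  rw [← Equiv.sum_comp (MulAction.toPerm σ) (fun y ↦ P.toLin ((shapiroCocycle X N hN hs f).1 σ y)
    ((coindFin Y N).ρ σ ((shapiroCocycle Y N hN hs g).1 τ) y))]
  simp only [MulAction.toPerm_apply, hsummand, Finset.sum_add_distrib, Finset.sum_sub_distrib]
  congr 1
  congr 1
  · -- `σ • B(τ)`: reindex along `z ↦ τ • z` and use `σ s(τz) = s(στz) n_σ(τz)`
    rw [map_sum, ← Equiv.sum_comp (MulAction.toPerm τ) (fun x ↦ Z.ρ (s (σ • x))
      (Z.ρ ((schreierElt N hs σ x : N) : G) (β (schreierElt N hs τ (τ⁻¹ • x)))))]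
    refine Finset.sum_congr rfl fun z _ ↦ ?_
    rw [MulAction.toPerm_apply, inv_smul_smul, ← ρ_mul_apply, rep_mul_schreierElt, ρ_mul_apply]
  · -- `B(στ)`: reindex along `z ↦ τ • z` and use the Schreier cocycle rule
    rw [← Equiv.sum_comp (MulAction.toPerm τ) (fun x ↦ Z.ρ (s (σ • x))
      (β (schreierElt N hs σ x * schreierElt N hs τ (τ⁻¹ • x))))]
    refine Finset.sum_congr rfl fun z _ ↦ ?_
    rw [MulAction.toPerm_apply, inv_smul_smul, ← schreierElt_mul, mul_smul]

end Summit.BirchSwinnertonDyer.BirchSwinnertonDyer.Theorems.SignedEC.ShapiroCup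

end
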